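import Summits.AtomisticToContinuum.BoseEinsteinCondensation.Theorems.BECHeatBathGapSquareSummableInfluenceMayersAlignmentTools
import HarnessLib

/-!
# Route `BECHeatBathGap`, crux `SquareSummableInfluence` (stmt-AtomisticToContinuum-14368), line `registered`:
# occupation ≥ INTRINSIC alignment functional − one bath particle's influence (division-free Mayers bound)

Supports (does not close) stmt-AtomisticToContinuum-14368 (lead c6). Companion of
`…MayersRepresentation.lean`: there the occupations of a Bose-symmetric `(N+1)`-body state `Ψ` were pinned to the
Mayers mixture functional weighted by the PAIR coefficient `|c(X̂)|²`; here the lower bound is made INTRINSIC. Project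
`Ψ` in the variable of the inserted particle `y = Z 0` onto the conditional one-particle amplitude
`θ_X̂ = Θ(X^{i→·})` of the bath state (`P_y Ψ = g⋆'_i θ_X̂(y)`): by Bessel on each fibre and the `√occ`-Lipschitz lemma,

* `occupation_ge_alignment_sub_leastSquares` — for Dirichlet, box-square-integrable `Θ`, `Ψ` with
  `Ψ ∘ swap(0, succ i) = Ψ`, every normalised mode `u` and every measurable test weight `κ ≤ 1` on bath configurations
  with `κ(X)·m_i(X) ≤ |⟨u 1_Λ, Θ(X^{i→·})⟩|²` (i.e. `κ ≤ |⟨u, θ̂_X̂⟩|²`, the squared overlap of `u` with the NORMALISED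
  conditional amplitude):
  `√(N+1) · (∫ |Ψ(Z)|² κ(tail Z) dZ − LS_i)^{1/2} ≤ occ(u, Ψ)^{1/2} + √(N+1) · LS_i^{1/2}`,
  `LS_i = ∫_{Λ^{N+1}}|Ψ − g⋆_i Θ(tail)|²` the least-squares influence of bath particle `i` (the projection defect in `y`
  equals the one in `x_i` by the transposition symmetry, as in `pairFactorisation_le_four_mul_leastSquares`).

Reading (ground states, `LS_i = I/N`): `λ_max(γ_{Ψ₀})/(N+1) ≥ E_{|Ψ₀|²}|⟨u, θ̂_X̂⟩|² − O(√(I/N))` for every `u` — the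
condensate fraction of the `(N+1)`-body ground state is at least the `|Ψ₀|²`-mean squared overlap of `u` with the
conditional one-particle amplitudes of the `N`-body ground state, as soon as ONE bath particle's influence is `o(1)`.
`[folklore]` (Bessel, Cauchy–Schwarz, Minkowski, Tonelli) + [cite: Mayers2001] for the reading.
-/

noncomputable section

open MeasureTheory Filter Function
open scoped ENNReal NNReal Topology ComplexConjugate InnerProductSpace

namespace Summit.AtomisticToContinuum.BoseEinsteinCondensation.Theorems.SquareSummableInfluence

open Literature.MathematicalPhysics.QuantumManyBody.BoseGas
open Summit.AtomisticToContinuum.BoseEinsteinCondensation.Theorems.SwapToZeroMode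

/-! ### The intrinsic Mayers bound -/

/-- **Occupation ≥ intrinsic alignment functional − one bath particle's influence.** Let `Θ : Λ_L^N → ℂ` (bath) and
`Ψ : Λ_L^{N+1} → ℂ` be measurable, Dirichlet (zero off the boxes), square integrable on the boxes, `i` a bath label with
`Ψ ∘ swap(0, succ i) = Ψ`, `u` a normalised mode, and `κ ≤ 1` a measurable TEST WEIGHT on bath configurations dominated
by the normalised squared overlap of `u` with the conditional one-particle amplitude of the bath state:
`κ(X) · ∫_Λ|Θ(X^{i→a})|²da ≤ |∫_Λ conj u(a) Θ(X^{i→a}) da|²` (i.e. `κ(X) ≤ |⟨u, θ̂_{X̂_i}⟩|²`, division-free). Then with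
`LS_i = ∫_{Λ^{N+1}}|Ψ − g⋆_i Θ(tail)|²` the least-squares influence of bath particle `i`:
`√(N+1) · (∫_{Λ^{N+1}} |Ψ(Z)|² κ(tail Z) dZ − LS_i)^{1/2} ≤ occ(u, Ψ)^{1/2} + √(N+1) · LS_i^{1/2}`.
Proof: project `Ψ` in the inserted variable `y` onto `θ_{X̂_i}` (`P_yΨ = g⋆'_i(X) Θ(X^{i→y})`): its occupation is
`(N+1)∫|g⋆'_i|²|⟨u1_Λ, Θ(X^{i→·})⟩|² ≥ (N+1)∫κ·(p₁ − fibre defect)` by Bessel on the `y`-fibre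
(`lintegral_sq_le_sq_div_add_leastSquares`) and `κ m ≤ |⟨u1_Λ, θ⟩|²`, `κ ≤ 1`; the total `y`-defect equals `LS_i` by the
transposition symmetry (measure-preserving relabelling, `setLIntegral_boxN_comp_perm`); finally `√occ` is
`√(N+1)`-Lipschitz (`occupation_rpow_half_le_add`). With `κ = |⟨u, θ̂⟩|²` and ground states this is Mayers' condensate
functional `E_{|Ψ₀|²}|⟨u, θ̂_X̂⟩|²` as a LOWER bound for `λ_max(γ_{Ψ₀})/(N+1)` up to `O(√(I/N))`. [cite: Mayers2001, Eq. (1)–(3)] -/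
theorem occupation_ge_alignment_sub_leastSquares :
    ∀ (N : ℕ) (L : ℝ) (Θ : Config N → ℂ) (Ψ : Config (N + 1) → ℂ), Measurable Θ → Measurable Ψ →
      (∀ X, X ∉ boxN N L → Θ X = 0) → (∀ Z, Z ∉ boxN (N + 1) L → Ψ Z = 0) →
      (∫⁻ X in boxN N L, (‖Θ X‖₊ : ℝ≥0∞) ^ 2) ≠ ⊤ →
      (∫⁻ Z in boxN (N + 1) L, (‖Ψ Z‖₊ : ℝ≥0∞) ^ 2) ≠ ⊤ → ∀ (i : Fin N),
      (∀ Z : Config (N + 1), Ψ (Z ∘ Equiv.swap (0 : Fin (N + 1)) (Fin.succ i)) = Ψ Z) →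
      ∀ (u : Space → ℂ) (κ : Config N → ℝ≥0∞), AEStronglyMeasurable u volume →
      (∫⁻ x, (‖u x‖₊ : ℝ≥0∞) ^ 2 = 1) → Measurable κ → (∀ X, κ X ≤ 1) →
      (∀ X, κ X * ∫⁻ a in box L, (‖Θ (Function.update X i a)‖₊ : ℝ≥0∞) ^ 2 ≤
        (‖∫ a in box L, conj (u a) * Θ (Function.update X i a)‖₊ : ℝ≥0∞) ^ 2) →
    ((N + 1 : ℕ) : ℝ≥0∞) ^ (1 / 2 : ℝ) *
        ((∫⁻ Z in boxN (N + 1) L, (‖Ψ Z‖₊ : ℝ≥0∞) ^ 2 * κ (Matrix.vecTail Z)) -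
          ∫⁻ Z in boxN (N + 1) L, (‖Ψ Z -
            ((∫ x in box L, conj (Θ (Matrix.vecTail (Function.update Z (Fin.succ i) x))) *
                Ψ (Function.update Z (Fin.succ i) x)) /
              (((∫⁻ x in box L, (‖Θ (Matrix.vecTail (Function.update Z (Fin.succ i) x))‖₊ : ℝ≥0∞) ^ 2).toReal
                : ℝ) : ℂ)) *
              Θ (Matrix.vecTail Z)‖₊ : ℝ≥0∞) ^ 2) ^ (1 / 2 : ℝ) ≤
      occupation (N + 1) u Ψ ^ (1 / 2 : ℝ) +
        ((N + 1 : ℕ) : ℝ≥0∞) ^ (1 / 2 : ℝ) *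
          (∫⁻ Z in boxN (N + 1) L, (‖Ψ Z -
            ((∫ x in box L, conj (Θ (Matrix.vecTail (Function.update Z (Fin.succ i) x))) *
                Ψ (Function.update Z (Fin.succ i) x)) /
              (((∫⁻ x in box L, (‖Θ (Matrix.vecTail (Function.update Z (Fin.succ i) x))‖₊ : ℝ≥0∞) ^ 2).toReal
                : ℝ) : ℂ)) *
              Θ (Matrix.vecTail Z)‖₊ : ℝ≥0∞) ^ 2) ^ (1 / 2 : ℝ) := by
  intro N L Θ Ψ hΘ hΨ hΘ0 hΨ0 hΘ2 hΨ2 i hsymm u κ hu hu1 hκm hκ1 hκ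
  -- notation (as in `pairFactorisation_le_four_mul_leastSquares`)
  set σ : Equiv.Perm (Fin (N + 1)) := Equiv.swap (0 : Fin (N + 1)) (Fin.succ i) with hσ
  have hU : Measurable fun p : Config (N + 1) × Space => Function.update p.1 (Fin.succ i) p.2 :=
    measurable_update'
  have hU0 : Measurable fun p : Config (N + 1) × Space => Function.update p.1 0 p.2 :=
    measurable_update'
  set θt : Config (N + 1) × Space → ℂ := fun p => Θ (Matrix.vecTail (Function.update p.1 (Fin.succ i) p.2))
    with hθt
  set ψt : Config (N + 1) × Space → ℂ := fun p => Ψ (Function.update p.1 (Fin.succ i) p.2) with hψt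
  set ψt0 : Config (N + 1) × Space → ℂ := fun p => Ψ (Function.update p.1 0 p.2) with hψt0
  have hθtm : Measurable θt := hΘ.comp (measurable_vecTail.comp hU)
  have hψtm : Measurable ψt := hΨ.comp hU
  have hψt0m : Measurable ψt0 := hΨ.comp hU0
  set m : Config (N + 1) → ℝ≥0∞ := fun Z => ∫⁻ x in box L, (‖θt (Z, x)‖₊ : ℝ≥0∞) ^ 2 with hm
  set o : Config (N + 1) → ℂ := fun Z => ∫ x in box L, conj (θt (Z, x)) * ψt (Z, x) with ho
  set gs : Config (N + 1) → ℂ := fun Z => o Z / (((m Z).toReal : ℝ) : ℂ) with hgs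
  set o' : Config (N + 1) → ℂ := fun Z => ∫ x in box L, conj (θt (Z, x)) * ψt0 (Z, x) with ho'
  set gs' : Config (N + 1) → ℂ := fun Z => o' Z / (((m Z).toReal : ℝ) : ℂ) with hgs'
  have hmm : Measurable m := (hθtm.nnnorm.coe_nnreal_ennreal.pow_const 2).lintegral_prod_right'
  have hconjθ : Measurable fun p : Config (N + 1) × Space => conj (θt p) :=
    Complex.continuous_conj.measurable.comp hθtm
  have hom : Measurable o :=
    ((hconjθ.mul hψtm).stronglyMeasurable.integral_prod_right'
      (ν := (volume : Measure Space).restrict (box L))).measurable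
  have ho'm : Measurable o' :=
    ((hconjθ.mul hψt0m).stronglyMeasurable.integral_prod_right'
      (ν := (volume : Measure Space).restrict (box L))).measurable
  have hmR : Measurable fun Z => (((m Z).toReal : ℝ) : ℂ) := Complex.measurable_ofReal.comp hmm.ennreal_toReal
  have hgsm : Measurable gs := hom.div hmR
  have hgs'm : Measurable gs' := ho'm.div hmR
  have h0ne : (0 : Fin (N + 1)) ≠ Fin.succ i := (Fin.succ_ne_zero i).symm
  have hθt_i : ∀ Z y x, θt (Function.update Z (Fin.succ i) y, x) = θt (Z, x) := fun Z y x => by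
    simp only [hθt, Function.update_idem]
  have hθt_0 : ∀ Z y x, θt (Function.update Z 0 y, x) = θt (Z, x) := fun Z y x => by
    simp only [hθt]
    rw [Function.update_comm h0ne, vecTail_update_zero']
  have hm_0 : ∀ Z y, m (Function.update Z 0 y) = m Z := fun Z y => by
    simp only [hm, hθt_0]
  have ho'_0 : ∀ Z y, o' (Function.update Z 0 y) = o' Z := fun Z y => by
    simp only [ho', hθt_0]
    simp only [hψt0, Function.update_idem]
  have hgs'_0 : ∀ Z y, gs' (Function.update Z 0 y) = gs' Z := fun Z y => by
    simp only [hgs', hm_0, ho'_0]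
  -- abbreviations for the two least-squares residuals and the target quantities
  have hΘt : Measurable fun Z : Config (N + 1) => Θ (Matrix.vecTail Z) := hΘ.comp measurable_vecTail
  have hθ0m : Measurable fun Z : Config (N + 1) => θt (Z, Z 0) :=
    hθtm.comp (measurable_id.prodMk (measurable_pi_apply 0))
  set A : Config (N + 1) → ℂ := fun Z => Ψ Z - gs Z * Θ (Matrix.vecTail Z) with hA
  set A' : Config (N + 1) → ℂ := fun Z => Ψ Z - gs' Z * θt (Z, Z 0) with hA'
  set P : Config (N + 1) → ℂ := fun Z => gs' Z * θt (Z, Z 0) with hP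
  have hAm : Measurable A := hΨ.sub (hgsm.mul hΘt)
  have hA'm : Measurable A' := hΨ.sub (hgs'm.mul hθ0m)
  have hPm : Measurable P := hgs'm.mul hθ0m
  set D : ℝ≥0∞ := ∫⁻ Z in boxN (N + 1) L, (‖A Z‖₊ : ℝ≥0∞) ^ 2 with hD
  set AL : ℝ≥0∞ := ∫⁻ Z in boxN (N + 1) L, (‖Ψ Z‖₊ : ℝ≥0∞) ^ 2 * κ (Matrix.vecTail Z) with hAL
  change ((N + 1 : ℕ) : ℝ≥0∞) ^ (1 / 2 : ℝ) * (AL - D) ^ (1 / 2 : ℝ) ≤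
    occupation (N + 1) u Ψ ^ (1 / 2 : ℝ) + ((N + 1 : ℕ) : ℝ≥0∞) ^ (1 / 2 : ℝ) * D ^ (1 / 2 : ℝ)
  -- the empty box
  rcases le_or_gt L 0 with hL | hL
  · have hAL0 : AL = 0 := by simp [hAL, boxN_succ_eq_empty_of_nonpos hL]
    rw [hAL0, zero_tsub, ENNReal.zero_rpow_of_pos (by norm_num : (0 : ℝ) < 1 / 2), mul_zero]
    exact bot_le
  -- Step 1: `A' = A ∘ swap`, hence the `y`-defect equals the `x_i`-defect `D`
  have hA'A : ∀ W, A' W = A (W ∘ σ) := by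
    intro W
    have hθσ : ∀ x, θt (W ∘ σ, x) = θt (W, x) := fun x => by
      simp only [hθt, hσ]
      rw [update_comp_swap, vecTail_comp_swap]
      simp only [Function.update_self]
      rw [show Function.update (Function.update W 0 x) (Fin.succ i) x =
          Function.update (Function.update W (Fin.succ i) x) 0 x from Function.update_comm h0ne _ _ _,
        vecTail_update_zero']
    have hmσ : m (W ∘ σ) = m W := by simp only [hm, hθσ]
    have hoσ : o (W ∘ σ) = o' W := by
      simp only [ho, ho', hθσ]
      refine integral_congr_ae (ae_of_all _ fun x => ?_)
      simp only [hψt, hψt0, hσ]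
      rw [update_comp_swap, hsymm]
    have hgsσ : gs (W ∘ σ) = gs' W := by simp only [hgs, hgs', hmσ, hoσ]
    have htail : Θ (Matrix.vecTail (W ∘ σ)) = θt (W, W 0) := by
      simp only [hθt, hσ, vecTail_comp_swap]
    simp only [hA, hA', hgsσ, htail, hsymm]
  have hD' : ∫⁻ Z in boxN (N + 1) L, (‖A' Z‖₊ : ℝ≥0∞) ^ 2 = D := by
    simp only [hA'A]
    exact setLIntegral_boxN_comp_perm L σ (G := fun Z => (‖A Z‖₊ : ℝ≥0∞) ^ 2)
      (hAm.nnnorm.coe_nnreal_ennreal.pow_const 2)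
  -- Step 2: `∫ |Ψ − P|² = D` on the whole space (both vanish off the box)
  have hPzero : ∀ Z, Z ∉ boxN (N + 1) L → P Z = 0 := by
    intro Z hZ
    simp only [boxN, Set.mem_setOf_eq, not_forall] at hZ
    obtain ⟨k, hk⟩ := hZ
    simp only [hP, hθt]
    refine Fin.cases ?_ (fun j hj => ?_) k hk
    · intro h0
      have : Matrix.vecTail (Function.update Z (Fin.succ i) (Z 0)) ∉ boxN N L := by
        intro hmem
        have h := hmem i
        rw [vecTail_update_succ, Function.update_self] at h
        exact h0 h
      rw [hΘ0 _ this, mul_zero]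
    · by_cases hji : j = i
      · subst hji
        -- the bath slot `j` itself is outside the box: the `y`-pairing `o'` vanishes
        have ho'0 : o' Z = 0 := by
          simp only [ho']
          refine integral_eq_zero_of_ae (ae_of_all _ fun x => ?_)
          simp only [hψt0, Pi.zero_apply]
          have : Function.update Z 0 x ∉ boxN (N + 1) L := fun hmem => by
            have h := hmem (Fin.succ j)
            rw [Function.update_of_ne (Fin.succ_ne_zero j)] at h
            exact hj h
          rw [hΨ0 _ this, mul_zero]
        simp only [hgs', ho'0, zero_div, zero_mul]
      · have : Matrix.vecTail (Function.update Z (Fin.succ i) (Z 0)) ∉ boxN N L := by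
          intro hmem
          have h := hmem j
          rw [vecTail_update_succ, Function.update_of_ne hji] at h
          exact hj h
        rw [hΘ0 _ this, mul_zero]
  have hdist : ∫⁻ Z, (‖P Z - Ψ Z‖₊ : ℝ≥0∞) ^ 2 = D := by
    rw [← hD', ← lintegral_indicator (measurableSet_boxN _ _)]
    refine lintegral_congr fun Z => ?_
    by_cases hZ : Z ∈ boxN (N + 1) L
    · rw [Set.indicator_of_mem hZ]
      simp only [hA', hP]
      rw [← nnnorm_neg, neg_sub]
    · rw [Set.indicator_of_notMem hZ, hΨ0 Z hZ, hPzero Z hZ, sub_zero, nnnorm_zero, ENNReal.coe_zero,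
        zero_pow two_ne_zero]
  -- Step 3: the occupation of the projection `P`
  set OX : Config N → ℂ := fun X => ∫ a in box L, conj (u a) * Θ (Function.update X i a) with hOX
  have hoccP : (N + 1 : ℝ≥0∞) * ∫⁻ X in boxN N L,
      (‖gs' (Matrix.vecCons 0 X)‖₊ : ℝ≥0∞) ^ 2 * (‖OX X‖₊ : ℝ≥0∞) ^ 2 ≤ occupation (N + 1) u P := by
    have hocc : occupation (N + 1) u P =
        (N + 1 : ℝ≥0∞) * ∫⁻ Y : Config N,
          (‖∫ x, conj (u x) * P (Matrix.vecCons x Y)‖₊ : ℝ≥0∞) ^ 2 := rfl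
    rw [hocc]
    refine mul_le_mul_right ((setLIntegral_le_lintegral _ _).trans (lintegral_mono fun X => le_of_eq ?_)) _
    have hslice : ∀ x : Space, conj (u x) * P (Matrix.vecCons x X) =
        gs' (Matrix.vecCons 0 X) * (conj (u x) * Θ (Function.update X i x)) := by
      intro x
      simp only [hP, hθt]
      rw [Matrix.cons_val_zero, update_vecCons_succ, Matrix.tail_cons, vecCons_eq_update_vecCons_zero x X,
        hgs'_0]
      ring
    simp only [hslice]
    rw [integral_const_mul, nnnorm_mul, ENNReal.coe_mul, mul_pow]
    congr 2
    simp only [hOX]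
    rw [setIntegral_eq_integral_of_forall_compl_eq_zero]
    intro a ha
    have : Function.update X i a ∉ boxN N L := fun hmem => by
      have h := hmem i
      rw [Function.update_self] at h
      exact ha h
    rw [hΘ0 _ this, mul_zero]
  -- Step 4: the fibre objects over the bath configuration `X` (inserted particle integrated out)
  set mX : Config N → ℝ≥0∞ := fun X => ∫⁻ a in box L, (‖Θ (Function.update X i a)‖₊ : ℝ≥0∞) ^ 2 with hmX
  set oX : Config N → ℂ := fun X => ∫ a in box L, conj (Θ (Function.update X i a)) * Ψ (Matrix.vecCons a X)
    with hoX
  set p₁ : Config N → ℝ≥0∞ := fun X => ∫⁻ a in box L, (‖Ψ (Matrix.vecCons a X)‖₊ : ℝ≥0∞) ^ 2 with hp₁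
  set fLS : Config N → ℝ≥0∞ := fun X => ∫⁻ a in box L,
    (‖Ψ (Matrix.vecCons a X) - gs' (Matrix.vecCons 0 X) * Θ (Function.update X i a)‖₊ : ℝ≥0∞) ^ 2 with hfLS
  have hmX_eq : ∀ X, m (Matrix.vecCons 0 X) = mX X := fun X => by
    simp only [hm, hmX, hθt, update_vecCons_succ, Matrix.tail_cons]
  have hoX_eq : ∀ X, o' (Matrix.vecCons 0 X) = oX X := fun X => by
    simp only [ho', hoX, hθt, hψt0, update_vecCons_succ, Matrix.tail_cons]
    refine integral_congr_ae (ae_of_all _ fun a => ?_)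
    simp only
    rw [update_zero_eq_vecCons_vecTail, Matrix.tail_cons]
  have hgsX : ∀ X, gs' (Matrix.vecCons 0 X) = oX X / (((mX X).toReal : ℝ) : ℂ) := fun X => by
    simp only [hgs', hmX_eq, hoX_eq]
  -- measurability over `X`
  have hUX : Measurable fun p : Config N × Space => Function.update p.1 i p.2 := measurable_update'
  have hΘu : Measurable fun p : Config N × Space => Θ (Function.update p.1 i p.2) := hΘ.comp hUX
  have hΨc : Measurable fun p : Config N × Space => Ψ (Matrix.vecCons p.2 p.1) :=
    hΨ.comp (measurable_vecCons.comp (measurable_snd.prodMk measurable_fst))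
  have hmXm : Measurable mX := (hΘu.nnnorm.coe_nnreal_ennreal.pow_const 2).lintegral_prod_right'
  have hp₁m : Measurable p₁ := (hΨc.nnnorm.coe_nnreal_ennreal.pow_const 2).lintegral_prod_right'
  have hgs0m : Measurable fun X : Config N => gs' (Matrix.vecCons 0 X) :=
    hgs'm.comp (measurable_vecCons.comp (measurable_const.prodMk measurable_id))
  have hfLSint : Measurable fun p : Config N × Space =>
      (‖Ψ (Matrix.vecCons p.2 p.1) - gs' (Matrix.vecCons 0 p.1) * Θ (Function.update p.1 i p.2)‖₊ : ℝ≥0∞) ^ 2 :=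
    (hΨc.sub ((hgs0m.comp measurable_fst).mul hΘu)).nnnorm.coe_nnreal_ennreal.pow_const 2
  have hfLSm : Measurable fLS := hfLSint.lintegral_prod_right'
  have hL3 : ENNReal.ofReal L ^ 3 ≠ 0 := pow_ne_zero _ (by simpa using hL)
  have hL3' : ENNReal.ofReal L ^ 3 ≠ ⊤ := ENNReal.pow_ne_top ENNReal.ofReal_ne_top
  -- a.e. finiteness of the fibre masses over the bath box
  have hmX_ae : ∀ᵐ X ∂(volume : Measure (Config N)).restrict (boxN N L), mX X < ⊤ := by
    refine ae_lt_top hmXm ?_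
    have hmarg : (∫⋯∫⁻_{i}, (fun X => (‖Θ X‖₊ : ℝ≥0∞) ^ 2)
        ∂fun _ : Fin N => (volume : Measure Space).restrict (box L)) = mX := by
      rw [lmarginal_singleton]
    rw [← hmarg, setLIntegral_boxN_lmarginal_singleton N L i (hΘ.nnnorm.coe_nnreal_ennreal.pow_const 2)]
    exact ENNReal.mul_ne_top hL3' hΘ2
  have hp₁_ae : ∀ᵐ X ∂(volume : Measure (Config N)).restrict (boxN N L), p₁ X < ⊤ := by
    refine ae_lt_top hp₁m ?_
    have h := setLIntegral_boxN_box_vecCons L (G := fun Z => (‖Ψ Z‖₊ : ℝ≥0∞) ^ 2)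
      (hΨ.nnnorm.coe_nnreal_ennreal.pow_const 2)
    rw [show (∫⁻ X in boxN N L, p₁ X) = ∫⁻ X in boxN N L, ∫⁻ y in box L,
      (‖Ψ (Matrix.vecCons y X)‖₊ : ℝ≥0∞) ^ 2 from rfl, h]
    exact hΨ2
  -- Step 5: the fibre inequality `κ p₁ ≤ |gs'|² |O_u|² + fLS`
  have hfib : ∀ᵐ X ∂(volume : Measure (Config N)).restrict (boxN N L),
      κ X * p₁ X ≤ (‖gs' (Matrix.vecCons 0 X)‖₊ : ℝ≥0∞) ^ 2 * (‖OX X‖₊ : ℝ≥0∞) ^ 2 + fLS X := by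
    filter_upwards [hmX_ae, hp₁_ae] with X hmXfin hp₁fin
    rcases eq_or_ne (mX X) 0 with hm0 | hm0
    · -- no `Θ`-mass on the fibre: `gs' = 0`, the defect is all of `p₁`, and `κ ≤ 1`
      have hg0 : gs' (Matrix.vecCons 0 X) = 0 := by
        rw [hgsX, hm0]
        simp
      have hfp : fLS X = p₁ X := by
        simp only [hfLS, hp₁, hg0, zero_mul, sub_zero]
      calc κ X * p₁ X ≤ 1 * p₁ X := by gcongr; exact hκ1 X
        _ = fLS X := by rw [one_mul, hfp]
        _ ≤ _ := le_add_self
    -- Bessel on the fibre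
    have hB := lintegral_sq_le_sq_div_add_leastSquares (μ := (volume : Measure Space).restrict (box L))
      (F := fun a => Ψ (Matrix.vecCons a X)) (θ := fun a => Θ (Function.update X i a))
      (hΨc.comp measurable_prodMk_left).aestronglyMeasurable
      (hΘu.comp measurable_prodMk_left).aestronglyMeasurable hp₁fin.ne hmXfin.ne
    have hB' : p₁ X ≤ (‖oX X‖₊ : ℝ≥0∞) ^ 2 / mX X + fLS X := by
      simpa only [hp₁, hoX, hmX, hfLS, hgsX] using hB
    -- real bookkeeping: `κ |oX|²/m ≤ |gs'|² |OX|²` from `κ m ≤ |OX|²`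
    have hMpos : 0 < (mX X).toReal := ENNReal.toReal_pos hm0 hmXfin.ne
    have hκfin : κ X ≠ ⊤ := ne_top_of_le_ne_top ENNReal.one_ne_top (hκ1 X)
    have hOfin : ((‖OX X‖₊ : ℝ≥0∞) ^ 2) ≠ ⊤ := ENNReal.pow_ne_top ENNReal.coe_ne_top
    have hkM : (κ X).toReal * (mX X).toReal ≤ ‖OX X‖ ^ 2 := by
      have h := hκ X
      have h' := (ENNReal.toReal_le_toReal (ENNReal.mul_ne_top hκfin hmXfin.ne) hOfin).2 h
      rw [ENNReal.toReal_mul] at h'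
      rw [coe_nnnorm_sq_eq_ofReal, ENNReal.toReal_ofReal (by positivity)] at h'
      exact h'
    have hgs_norm : (‖gs' (Matrix.vecCons 0 X)‖₊ : ℝ≥0∞) ^ 2 =
        ENNReal.ofReal (‖oX X‖ ^ 2 / (mX X).toReal ^ 2) := by
      rw [coe_nnnorm_sq_eq_ofReal, hgsX, norm_div, Complex.norm_real, Real.norm_of_nonneg hMpos.le, div_pow]
    have hstep : κ X * ((‖oX X‖₊ : ℝ≥0∞) ^ 2 / mX X) ≤
        (‖gs' (Matrix.vecCons 0 X)‖₊ : ℝ≥0∞) ^ 2 * (‖OX X‖₊ : ℝ≥0∞) ^ 2 := by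
      have hreal : (κ X).toReal * (‖oX X‖ ^ 2 / (mX X).toReal) ≤
          ‖oX X‖ ^ 2 / (mX X).toReal ^ 2 * ‖OX X‖ ^ 2 := by
        have h := mul_le_mul_of_nonneg_left hkM (by positivity : (0 : ℝ) ≤ ‖oX X‖ ^ 2 / (mX X).toReal ^ 2)
        calc (κ X).toReal * (‖oX X‖ ^ 2 / (mX X).toReal)
            = ‖oX X‖ ^ 2 / (mX X).toReal ^ 2 * ((κ X).toReal * (mX X).toReal) := by
              field_simp
          _ ≤ ‖oX X‖ ^ 2 / (mX X).toReal ^ 2 * ‖OX X‖ ^ 2 := h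
      have hLhs : κ X * ((‖oX X‖₊ : ℝ≥0∞) ^ 2 / mX X) =
          ENNReal.ofReal ((κ X).toReal * (‖oX X‖ ^ 2 / (mX X).toReal)) := by
        rw [ENNReal.ofReal_mul ENNReal.toReal_nonneg, ENNReal.ofReal_toReal hκfin,
          ENNReal.ofReal_div_of_pos hMpos, ← coe_nnnorm_sq_eq_ofReal, ENNReal.ofReal_toReal hmXfin.ne]
      have hRhs : (‖gs' (Matrix.vecCons 0 X)‖₊ : ℝ≥0∞) ^ 2 * (‖OX X‖₊ : ℝ≥0∞) ^ 2 =
          ENNReal.ofReal (‖oX X‖ ^ 2 / (mX X).toReal ^ 2 * ‖OX X‖ ^ 2) := by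
        rw [hgs_norm, coe_nnnorm_sq_eq_ofReal (OX X), ← ENNReal.ofReal_mul (by positivity)]
      rw [hLhs, hRhs]
      exact ENNReal.ofReal_le_ofReal hreal
    calc κ X * p₁ X ≤ κ X * ((‖oX X‖₊ : ℝ≥0∞) ^ 2 / mX X + fLS X) := mul_le_mul_right hB' _
      _ = κ X * ((‖oX X‖₊ : ℝ≥0∞) ^ 2 / mX X) + κ X * fLS X := mul_add _ _ _
      _ ≤ (‖gs' (Matrix.vecCons 0 X)‖₊ : ℝ≥0∞) ^ 2 * (‖OX X‖₊ : ℝ≥0∞) ^ 2 + 1 * fLS X :=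
          add_le_add hstep (mul_le_mul_left (hκ1 X) _)
      _ = _ := by rw [one_mul]
  -- Step 6: integrate over the bath box
  have hALeq : AL = ∫⁻ X in boxN N L, κ X * p₁ X := by
    have h := setLIntegral_boxN_box_vecCons L (G := fun Z => (‖Ψ Z‖₊ : ℝ≥0∞) ^ 2 * κ (Matrix.vecTail Z))
      ((hΨ.nnnorm.coe_nnreal_ennreal.pow_const 2).mul (hκm.comp measurable_vecTail))
    rw [hAL, ← h]
    refine lintegral_congr fun X => ?_
    simp only [Matrix.tail_cons, hp₁]
    have hmeas : Measurable fun y : Space => (‖Ψ (Matrix.vecCons y X)‖₊ : ℝ≥0∞) ^ 2 :=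
      (hΨ.comp (measurable_vecCons.comp (measurable_id.prodMk measurable_const))).nnnorm.coe_nnreal_ennreal.pow_const 2
    rw [lintegral_mul_const _ hmeas, mul_comm]
  have hfLSeq : ∫⁻ X in boxN N L, fLS X = D := by
    rw [← hD']
    have h := setLIntegral_boxN_box_vecCons L (G := fun Z => (‖A' Z‖₊ : ℝ≥0∞) ^ 2)
      (hA'm.nnnorm.coe_nnreal_ennreal.pow_const 2)
    rw [← h]
    refine lintegral_congr fun X => lintegral_congr fun a => ?_
    simp only [hA', hθt]
    rw [Matrix.cons_val_zero, update_vecCons_succ, Matrix.tail_cons, vecCons_eq_update_vecCons_zero a X, hgs'_0]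
  have hALle : AL ≤ (∫⁻ X in boxN N L,
      (‖gs' (Matrix.vecCons 0 X)‖₊ : ℝ≥0∞) ^ 2 * (‖OX X‖₊ : ℝ≥0∞) ^ 2) + D := by
    rw [hALeq, ← hfLSeq, ← lintegral_add_right _ hfLSm]
    exact lintegral_mono_ae hfib
  have hN : ((N + 1 : ℕ) : ℝ≥0∞) = (N + 1 : ℝ≥0∞) := by push_cast; rfl
  have hkey : ((N + 1 : ℕ) : ℝ≥0∞) * (AL - D) ≤ occupation (N + 1) u P := by
    rw [hN]
    refine le_trans ?_ hoccP
    gcongr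
    exact tsub_le_iff_right.2 hALle
  -- Step 7: `√occ` is `√(N+1)`-Lipschitz
  have hlip := occupation_rpow_half_le_add hu hu1 hPm hΨ (c := 1) (by simp)
  simp only [one_mul] at hlip
  rw [hdist] at hlip
  calc ((N + 1 : ℕ) : ℝ≥0∞) ^ (1 / 2 : ℝ) * (AL - D) ^ (1 / 2 : ℝ)
      = (((N + 1 : ℕ) : ℝ≥0∞) * (AL - D)) ^ (1 / 2 : ℝ) :=
        (ENNReal.mul_rpow_of_nonneg _ _ (by norm_num : (0 : ℝ) ≤ 1 / 2)).symm
    _ ≤ occupation (N + 1) u P ^ (1 / 2 : ℝ) := by gcongr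
    _ ≤ occupation (N + 1) u Ψ ^ (1 / 2 : ℝ) + ((N + 1 : ℕ) : ℝ≥0∞) ^ (1 / 2 : ℝ) * D ^ (1 / 2 : ℝ) := hlip

end Summit.AtomisticToContinuum.BoseEinsteinCondensation.Theorems.SquareSummableInfluence

end
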